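import Literature.Geometry.Kaehler.ChartBallTransportDefectsDep
import Literature.AlgebraicGeometry.HodgeTheory.TransportedHarmonicRepresentatives
import Literature.NumberTheory.Transcendental.ComplexFormsPullback
import Literature.NumberTheory.Transcendental.DeRhamTheorem
import Mathlib.Analysis.InnerProductSpace.Orientation
import HarnessLib

/-!
# Continuity of the transported harmonic projectors `z ↦ e_z^* Π^{<p} η^{(z)}_c` over the chart ball — DEPENDENT fibre
# diffeomorphisms (Voisin I §9.3.2 / §10.2.2, soft form)

Layer `Literature/AlgebraicGeometry/HodgeTheory`; one theorem, no definition, no named fact.  Prover seat `hodge-nonav-19716-p2`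
(g11, cell `hodge-nonav`), brick **K1-3b** of prover-Bx's programme «GRIFFITHS-HOLOMORPHY» in the form its consumer (K7) can apply:
`HarmonicProjectorTransportContinuous.continuousAt_transported_harmonicProjector` takes a TOTAL family
`e : ∀ p : EB, X s₀ ≅ X (c⁻¹ p)`, but clause (4) of `IsProperHolomorphicSubmersion.exists_chartBall_trivialisation` (the only
producer) gives a DEPENDENT family `e : ∀ p ∈ ball (c s₀) r, X s₀ ≅ X (c⁻¹ p)` (a total one need not exist).  This file re-proves
the estimate with the dependent binders `(e : ∀ p ∈ ball (c s₀) r, …)`, `(he : ∀ p (hp : p ∈ ball) x, ι (c⁻¹ p) (e p hp x) = Φ p x)`;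
the orientation fields `o z` and the family `L z` stay TOTAL in `z` (their hypotheses are asserted on the ball only), the
hypotheses `hcmp`, `hΨo`, `hL` carry the membership proofs `hz` feeding `e z hz`.
* **`continuousAt_transported_harmonicProjector_dep`** — given the uniform `L²` comparison over a ball of radius `r₁`
  (output of `ChartBallL2ComparisonDep`), the orientation compatibility of `Ψ = (e z₂ hz₂)⁻¹ ≫ e z hz`, harmonic-representative
  maps `hr z hz` on the fibres over the ball, and a family `L z` whose forms are `e^* (Π^{<p} η^{(z)}_c)` (`e = e z hz`): `z ↦ L z c`
  is continuous at `z₂`.  Proof = the proof of `continuousAt_transported_harmonicProjector` ((A) harmonic stability, (B)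
  type-projector commutation, (C) `‖Π^{<p} w‖ ≤ (k+1)‖w‖`, (D) the comparison), fed `eventually_transport_defects_le_dep`.
HONEST FRAMING: an analytic brick; nothing here says HC or any rung is proved.

## References
* [VoisinHodgeI2002] C. Voisin, Hodge Theory and Complex Algebraic Geometry I (2002), §5.1.1, §9.3.2 Prop. 9.20, §10.2.2.
* [Kodaira2005] K. Kodaira, Complex Manifolds and Deformation of Complex Structures, §7.2 Thm. 7.3.
-/

noncomputable section

open scoped Manifold ContDiff Topology InnerProductSpace
open Bundle Module Set Filter Function Metric Finset
open Literature.Geometry.Kaehler Literature.Geometry.Manifold Literature.NumberTheory.Transcendental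
  Literature.AlgebraicGeometry.Motives

namespace Literature.AlgebraicGeometry.HodgeTheory

-- The identification `TangentSpace I x = E` is an abuse of definitional equality; as in the tree's
-- tangent-bundle files we let `isDefEq` unfold it.
set_option backward.isDefEq.respectTransparency false

universe u

section ChartBall

variable {EX : Type u} [NormedAddCommGroup EX] [NormedSpace ℂ EX] [FiniteDimensional ℂ EX]
  [MeasurableSpace EX] [BorelSpace EX]
  {E𝒳 : Type u} [NormedAddCommGroup E𝒳] [NormedSpace ℂ E𝒳] [FiniteDimensional ℂ E𝒳]
  {𝒳 : Type u} [TopologicalSpace 𝒳] [ChartedSpace E𝒳 𝒳] [IsManifold 𝓘(ℂ, E𝒳) ω 𝒳]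
  [IsManifold 𝓘(ℝ, E𝒳) ∞ 𝒳]
  {EB : Type u} [NormedAddCommGroup EB] [NormedSpace ℂ EB]
  {B : Type u} [TopologicalSpace B] [ChartedSpace EB B]
  {proj : 𝒳 → B}
  (G : ContMDiffRiemannianMetric 𝓘(ℝ, E𝒳) ∞ E𝒳 (fun y : 𝒳 ↦ TangentSpace 𝓘(ℝ, E𝒳) y))
  {X : B → Type u} [∀ b, TopologicalSpace (X b)] [∀ b, ChartedSpace EX (X b)]
  [∀ b, IsManifold 𝓘(ℂ, EX) ω (X b)] [∀ b, IsManifold 𝓘(ℝ, EX) ∞ (X b)]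
  [∀ b, CompactSpace (X b)] [∀ b, T2Space (X b)]
  {ι : ∀ b, X b → 𝒳}

set_option maxHeartbeats 800000 in
/-- **Continuity of the transported harmonic projectors, dependent fibre diffeomorphisms** at a point `z₂` of the small ball
(`continuousAt_transported_harmonicProjector` with `e : ∀ p ∈ ball, …` as produced by clause (4) of
`exists_chartBall_trivialisation`; see the module docstring for the data and the chain (A)–(D)). [cite: VoisinHodgeI2002, §9.3.2 Prop. 9.20 and §10.2.2] [cite: Kodaira2005, §7.2 Thm. 7.3] -/
theorem continuousAt_transported_harmonicProjector_dep {O : Set B} (hι : ∀ b ∈ O, IsFibreEmbedding EX E𝒳 proj b (ι b))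
    (g : ∀ b, ContMDiffRiemannianMetric 𝓘(ℝ, EX) ∞ EX (fun x : X b ↦ TangentSpace 𝓘(ℝ, EX) x))
    (hg : ∀ b ∈ O, ∀ (x : X b) (v w : TangentSpace 𝓘(ℝ, EX) x), (g b).inner x v w =
      G.inner (ι b x) (mfderiv 𝓘(ℝ, EX) 𝓘(ℝ, E𝒳) (ι b) x v) (mfderiv 𝓘(ℝ, EX) 𝓘(ℝ, E𝒳) (ι b) x w))
    (hgK : ∀ b ∈ O, (g b).toRiemannianMetric.IsKaehler)
    {s₀ : B} {r : ℝ} {Φ : EB → X s₀ → 𝒳}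
    (hbO : ∀ p ∈ ball (extChartAt 𝓘(ℂ, EB) s₀ s₀) r, (extChartAt 𝓘(ℂ, EB) s₀).symm p ∈ O)
    (hΦs : ContMDiffOn (𝓘(ℝ, EB).prod 𝓘(ℝ, EX)) 𝓘(ℝ, E𝒳) ∞ (uncurry Φ)
      (ball (extChartAt 𝓘(ℂ, EB) s₀ s₀) r ×ˢ univ))
    (e : ∀ p ∈ ball (extChartAt 𝓘(ℂ, EB) s₀ s₀) r, X s₀ ≃ₘ^∞⟮𝓘(ℝ, EX), 𝓘(ℝ, EX)⟯ X ((extChartAt 𝓘(ℂ, EB) s₀).symm p))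
    (he : ∀ p (hp : p ∈ ball (extChartAt 𝓘(ℂ, EB) s₀ s₀) r), ∀ x,
      ι ((extChartAt 𝓘(ℂ, EB) s₀).symm p) (e p hp x) = Φ p x)
    {N : ℕ} [Fact (finrank ℝ EX = N)]
    (o₀ : (x : X s₀) → Orientation ℝ (TangentSpace 𝓘(ℝ, EX) x) (Fin N))
    (o : ∀ z : EB, (y : X ((extChartAt 𝓘(ℂ, EB) s₀).symm z)) → Orientation ℝ (TangentSpace 𝓘(ℝ, EX) y) (Fin N))
    {k m : ℕ} (hkm : k + m = N) (p : ℕ) :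
    letI : ∀ b', RiemannianBundle (fun x : X b' ↦ TangentSpace 𝓘(ℝ, EX) x) := fun b' ↦ ⟨(g b').toRiemannianMetric⟩
    ∀ (ho₀ : IsSmoothForm (riemannianVolumeForm o₀))
      (ho : ∀ z ∈ ball (extChartAt 𝓘(ℂ, EB) s₀ s₀) r, IsSmoothForm (riemannianVolumeForm (o z)))
      {r₁ : ℝ} (_hr₁ : r₁ ≤ r)
      -- (D) the uniform `L²` comparison with the central fibre over the small ball
      (hcmp : ∀ z (hz : z ∈ ball (extChartAt 𝓘(ℂ, EB) s₀ s₀) r), z ∈ ball (extChartAt 𝓘(ℂ, EB) s₀ s₀) r₁ →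
        ∀ (α₁ : MForm 𝓘(ℝ, EX) (X ((extChartAt 𝓘(ℂ, EB) s₀).symm z)) ℂ k), IsSmoothForm α₁ →
          (MForm.cl2Inner o₀ (α₁.pullback 𝓘(ℝ, EX) (e z hz)) (α₁.pullback 𝓘(ℝ, EX) (e z hz))).re ≤
            2 * (MForm.cl2Inner (o z) α₁ α₁).re)
      -- the point under study, an oriented orthonormal frame field there, orientation compatibility of the transitions
      {z₂ : EB} (hz₂ : z₂ ∈ ball (extChartAt 𝓘(ℂ, EB) s₀ s₀) r₁) (hz₂r : z₂ ∈ ball (extChartAt 𝓘(ℂ, EB) s₀ s₀) r)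
      (b₂ : ∀ x : X ((extChartAt 𝓘(ℂ, EB) s₀).symm z₂), OrthonormalBasis (Fin N) ℝ (TangentSpace 𝓘(ℝ, EX) x))
      (_hb₂ : ∀ x, (b₂ x).toBasis.orientation = o z₂ x)
      (hΨo : ∀ z (hz : z ∈ ball (extChartAt 𝓘(ℂ, EB) s₀ s₀) r), ∀ x,
        Orientation.map (Fin N)
            (((e z₂ hz₂r).symm.trans (e z hz)).mfderivToContinuousLinearEquiv (by simp) x).toLinearEquiv (o z₂ x) =
          o z (((e z₂ hz₂r).symm.trans (e z hz)) x))
      -- harmonic representatives on the fibres over the ball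
      (hr : ∀ z, z ∈ ball (extChartAt 𝓘(ℂ, EB) s₀ s₀) r →
        complexDeRhamCohomology EX (X ((extChartAt 𝓘(ℂ, EB) s₀).symm z)) k →ₗ[ℂ]
          ↥(cclosedSmoothForms EX (X ((extChartAt 𝓘(ℂ, EB) s₀).symm z)) k))
      (hharm : ∀ z (hz : z ∈ ball (extChartAt 𝓘(ℂ, EB) s₀ s₀) r) c',
        IsCHarmonicForm (o z) hkm (hr z hz c' : MForm 𝓘(ℝ, EX) (X ((extChartAt 𝓘(ℂ, EB) s₀).symm z)) ℂ k))
      (hmk : ∀ z (hz : z ∈ ball (extChartAt 𝓘(ℂ, EB) s₀ s₀) r) c',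
        complexDeRhamCohomology.mk EX (X ((extChartAt 𝓘(ℂ, EB) s₀).symm z)) k (hr z hz c') = c')
      -- the family, characterised by its forms
      (L : haveI : Fact (IsSmoothForm (riemannianVolumeForm o₀)) := ⟨ho₀⟩
        EB → (complexDeRhamCohomology EX (X s₀) k →ₗ[ℂ] CL2SmoothForms o₀ k))
      (hL : haveI : Fact (IsSmoothForm (riemannianVolumeForm o₀)) := ⟨ho₀⟩
        ∀ z (hz : z ∈ ball (extChartAt 𝓘(ℂ, EB) s₀ s₀) r) (c : complexDeRhamCohomology EX (X s₀) k),
        CL2SmoothForms.toForm o₀ (L z c) =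
          (∑ pq ∈ (antidiagonal k).filter (fun pq ↦ pq.1 < p),
            (hr z hz (complexDeRhamCohomology.map EX (e z hz).symm.contMDiff k c) :
              MForm 𝓘(ℝ, EX) (X ((extChartAt 𝓘(ℂ, EB) s₀).symm z)) ℂ k).typeComponent pq.1 pq.2).pullback 𝓘(ℝ, EX) (e z hz))
      (c : complexDeRhamCohomology EX (X s₀) k),
      haveI : Fact (IsSmoothForm (riemannianVolumeForm o₀)) := ⟨ho₀⟩
      ContinuousAt (fun z ↦ L z c) z₂ := by
  letI iX : ∀ b', RiemannianBundle (fun x : X b' ↦ TangentSpace 𝓘(ℝ, EX) x) := fun b' ↦ ⟨(g b').toRiemannianMetric⟩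
  intro ho₀ ho r₁ hr₁ hcmp z₂ hz₂ hz₂r b₂ hb₂ hΨo hr hharm hmk L hL c
  haveI hF₀ : Fact (IsSmoothForm (riemannianVolumeForm o₀)) := ⟨ho₀⟩
  haveI : ∀ b', IsContMDiffRiemannianBundle 𝓘(ℝ, EX) ∞ EX (fun x : X b' ↦ TangentSpace 𝓘(ℝ, EX) x) :=
    fun b' ↦ ⟨(g b').inner, (g b').contMDiff, fun _ _ _ ↦ rfl⟩
  classical
  -- ### notation at the point `z₂`
  set M₂ := X ((extChartAt 𝓘(ℂ, EB) s₀).symm z₂) with hM₂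
  haveI hF₂ : Fact (IsSmoothForm (riemannianVolumeForm (o z₂))) := ⟨ho z₂ hz₂r⟩
  have hK₂ := hgK _ (hbO z₂ hz₂r)
  have hJ₂ : ∀ (x : X ((extChartAt 𝓘(ℂ, EB) s₀).symm z₂)) (v w : TangentSpace 𝓘(ℝ, EX) x),
      ⟪tangentJ EX x v, tangentJ EX x w⟫_ℝ = ⟪v, w⟫_ℝ := fun x v w ↦ hK₂.isHermitian x v w
  -- the transports of the class `c`: `S z c = (e_z⁻¹)^* c`
  set S₂ := complexDeRhamCohomology.map EX (e z₂ hz₂r).symm.contMDiff k with hS₂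
  -- the harmonic representative at `z₂` and its norm
  set η₂ : MForm 𝓘(ℝ, EX) (X ((extChartAt 𝓘(ℂ, EB) s₀).symm z₂)) ℂ k :=
    ((hr z₂ hz₂r (S₂ c) : ↥(cclosedSmoothForms EX (X ((extChartAt 𝓘(ℂ, EB) s₀).symm z₂)) k)) :
      MForm 𝓘(ℝ, EX) (X ((extChartAt 𝓘(ℂ, EB) s₀).symm z₂)) ℂ k) with hη₂
  have hη₂h : IsCHarmonicForm (o z₂) hkm η₂ := hharm z₂ hz₂r (S₂ c)
  set n₂ : ℝ := ‖CL2SmoothForms.mk (o z₂) η₂ hη₂h.1‖ with hn₂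
  have hn₂0 : 0 ≤ n₂ := norm_nonneg _
  -- the constant of (B)
  set Cst : ℝ := 4 * ((k : ℝ) + 2) * ((k : ℝ) + 1) * Real.sqrt (4 * (N : ℝ) ^ (2 * k) * ((k : ℝ) * 2 ^ (k - 1) * 2 ^ k) ^ 2) with hCst
  have hCst0 : 0 ≤ Cst := by positivity
  -- ### the `ε`-`δ` argument
  rw [Metric.continuousAt_iff']
  intro ε hε
  -- accuracy `ε₁` for (A) and (B)
  set K₀ : ℝ := 2 * (2 * Cst + ((k : ℝ) + 1)) * (n₂ + 1) with hK₀
  have hK₀pos : 0 < K₀ := by positivity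
  set ε₁ : ℝ := min 1 (ε / (2 * K₀)) with hε₁
  have hε₁pos : 0 < ε₁ := lt_min one_pos (by positivity)
  have hε₁1 : ε₁ ≤ 1 := min_le_left _ _
  have hε₁ε : ε₁ ≤ ε / (2 * K₀) := min_le_right _ _
  -- (A) the stability threshold of harmonic representatives on `(X (c⁻¹ z₂), g, o z₂)`
  obtain ⟨δA, hδA, hA⟩ := exists_forall_norm_pullback_harmonic_sub_le (g ((extChartAt 𝓘(ℂ, EB) s₀).symm z₂)) (o z₂) hkm
    hε₁pos (ho z₂ hz₂r) b₂ hb₂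
  -- (B) the threshold of the type-projector commutation
  obtain ⟨δB, hδB, hB⟩ := exists_forall_norm_pullback_typeLow_sub_le (g ((extChartAt 𝓘(ℂ, EB) s₀).symm z₂)) (o z₂) k p
    hJ₂ (ho z₂ hz₂r) b₂ hb₂
  -- the defects of `Ψ = (e z₂ hz₂r)⁻¹ ≫ e z` are eventually below all thresholds (K0 at `z₂`)
  set ε₀ : ℝ := min (min δA δB) ε₁ with hε₀
  have hε₀pos : 0 < ε₀ := lt_min (lt_min hδA hδB) hε₁pos
  have hε₀A : ε₀ ≤ δA := (min_le_left _ _).trans (min_le_left _ _)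
  have hε₀B : ε₀ ≤ δB := (min_le_left _ _).trans (min_le_right _ _)
  have hε₀1 : ε₀ ≤ ε₁ := min_le_right _ _
  have hev := eventually_transport_defects_le_dep G hι g hg hbO hΦs e he hz₂r hε₀pos b₂
  filter_upwards [hev] with z hz'
  obtain ⟨hzr, hT, hJ⟩ := hz'
  -- ### the objects at `z`
  haveI hFz : Fact (IsSmoothForm (riemannianVolumeForm (o z))) := ⟨ho z hzr⟩
  have hKz := hgK _ (hbO z hzr)
  have hJz : ∀ (x : X ((extChartAt 𝓘(ℂ, EB) s₀).symm z)) (v w : TangentSpace 𝓘(ℝ, EX) x),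
      ⟪tangentJ EX x v, tangentJ EX x w⟫_ℝ = ⟪v, w⟫_ℝ := fun x v w ↦ hKz.isHermitian x v w
  set Ψ := (e z₂ hz₂r).symm.trans (e z hzr) with hΨ
  set Sz := complexDeRhamCohomology.map EX (e z hzr).symm.contMDiff k with hSz
  set ηz : MForm 𝓘(ℝ, EX) (X ((extChartAt 𝓘(ℂ, EB) s₀).symm z)) ℂ k :=
    ((hr z hzr (Sz c) : ↥(cclosedSmoothForms EX (X ((extChartAt 𝓘(ℂ, EB) s₀).symm z)) k)) :
      MForm 𝓘(ℝ, EX) (X ((extChartAt 𝓘(ℂ, EB) s₀).symm z)) ℂ k) with hηz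
  have hηzh : IsCHarmonicForm (o z) hkm ηz := hharm z hzr (Sz c)
  -- exactness of `Ψ^* η_z − η₂`: both represent `(e_{z₂}⁻¹)^* c`
  have hex : ηz.pullback 𝓘(ℝ, EX) Ψ - η₂ ∈ cexactSmoothForms EX (X ((extChartAt 𝓘(ℂ, EB) s₀).symm z₂)) k := by
    have hcomp : complexDeRhamCohomology.map EX Ψ.contMDiff k ∘ₗ Sz = S₂ := by
      rw [hSz, hS₂, ← complexDeRhamCohomology.map_comp (e z hzr).symm.contMDiff Ψ.contMDiff k]
      have hfun : (((e z hzr).symm : _ → X s₀) ∘ (Ψ : _ → _)) = ((e z₂ hz₂r).symm : _ → X s₀) := by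
        funext y
        simp [hΨ, Diffeomorph.coe_trans]
      exact complexDeRhamCohomology.map_congr _ (e z₂ hz₂r).symm.contMDiff hfun k
    have e2 : complexDeRhamCohomology.map EX Ψ.contMDiff k (Sz c) = S₂ c := by
      have := LinearMap.congr_fun hcomp c
      simpa using this
    have hcl : complexDeRhamCohomology.mk EX _ k ⟨ηz.pullback 𝓘(ℝ, EX) Ψ, pullback_mem_cclosedSmoothForms Ψ.contMDiff
        (hr z hzr (Sz c)).2⟩ = complexDeRhamCohomology.mk EX _ k (hr z₂ hz₂r (S₂ c)) := by
      rw [hmk z₂ hz₂r, ← e2]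
      conv_rhs => rw [← hmk z hzr (Sz c), complexDeRhamCohomology.map_mk]
    have h := (complexDeRhamCohomology.mk_eq_mk_iff _ _).1 hcl
    simpa [hη₂] using h
  -- (A) harmonic stability
  have hAz := hA (o z) (ho z hzr) Ψ (hΨo z hzr) hε₀pos.le hε₀A hT hη₂h hηzh hex
  -- the pulled-back harmonic form and its norm
  have hΨηs : IsSmoothForm (ηz.pullback 𝓘(ℝ, EX) Ψ) := isSmoothForm_pullback Ψ.contMDiff hηzh.1
  have hnormΨη : ‖CL2SmoothForms.mk (o z₂) (ηz.pullback 𝓘(ℝ, EX) Ψ) hΨηs‖ ≤ (1 + ε₁) * n₂ := by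
    have h1 : ‖CL2SmoothForms.mk (o z₂) (ηz.pullback 𝓘(ℝ, EX) Ψ) hΨηs‖ ≤
        ‖CL2SmoothForms.mk (o z₂) (ηz.pullback 𝓘(ℝ, EX) Ψ) hΨηs - CL2SmoothForms.mk (o z₂) η₂ hη₂h.1‖ +
          ‖CL2SmoothForms.mk (o z₂) η₂ hη₂h.1‖ := norm_le_norm_sub_add _ _
    have h2 := hAz
    rw [hn₂]
    nlinarith [norm_nonneg (CL2SmoothForms.mk (o z₂) η₂ hη₂h.1)]
  -- (B) commutation of the type projector with `Ψ^*`
  set Sp := (antidiagonal k).filter (fun pq ↦ pq.1 < p) with hSp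
  have hSp : Sp ⊆ antidiagonal k := Finset.filter_subset _ _
  set θz : MForm 𝓘(ℝ, EX) (X ((extChartAt 𝓘(ℂ, EB) s₀).symm z)) ℂ k := ∑ pq ∈ Sp, ηz.typeComponent pq.1 pq.2 with hθz
  set θ₂ : MForm 𝓘(ℝ, EX) (X ((extChartAt 𝓘(ℂ, EB) s₀).symm z₂)) ℂ k := ∑ pq ∈ Sp, η₂.typeComponent pq.1 pq.2 with hθ₂
  have hθzs : IsSmoothForm θz := (smoothForms 𝓘(ℝ, EX) _ ℂ k).sum_mem fun pq _ ↦ hηzh.1.typeComponent pq.1 pq.2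
  have hθ₂s : IsSmoothForm θ₂ := (smoothForms 𝓘(ℝ, EX) _ ℂ k).sum_mem fun pq _ ↦ hη₂h.1.typeComponent pq.1 pq.2
  have hΨθs : IsSmoothForm (θz.pullback 𝓘(ℝ, EX) Ψ) := isSmoothForm_pullback Ψ.contMDiff hθzs
  set πΨη : MForm 𝓘(ℝ, EX) (X ((extChartAt 𝓘(ℂ, EB) s₀).symm z₂)) ℂ k :=
    ∑ pq ∈ Sp, (ηz.pullback 𝓘(ℝ, EX) Ψ).typeComponent pq.1 pq.2 with hπΨη
  have hπΨηs : IsSmoothForm πΨη := (smoothForms 𝓘(ℝ, EX) _ ℂ k).sum_mem fun pq _ ↦ hΨηs.typeComponent pq.1 pq.2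
  have hBz := hB (o z) (ho z hzr) hJz Ψ (hΨo z hzr) hε₀pos.le hε₀B hT hε₀pos.le hJ hηzh.1 hΨθs hπΨηs hΨηs
  -- (C) the projector is bounded by `k + 1` on the difference `Ψ^*η_z − η₂`
  have hdiffs : IsSmoothForm (ηz.pullback 𝓘(ℝ, EX) Ψ - η₂) := hΨηs.sub hη₂h.1
  have hπdiffs : IsSmoothForm (∑ pq ∈ Sp, (ηz.pullback 𝓘(ℝ, EX) Ψ - η₂).typeComponent pq.1 pq.2) :=
    (smoothForms 𝓘(ℝ, EX) _ ℂ k).sum_mem fun pq _ ↦ hdiffs.typeComponent pq.1 pq.2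
  have hCz := norm_mk_sum_typeComponent_le (o z₂) hJ₂ Sp hSp hdiffs hπdiffs
  -- ### assembling: the form of `L z c − L z₂ c` is `e_{z₂}^* (Ψ^* θ_z − θ₂)`
  have htoF : ∀ a b : CL2SmoothForms o₀ k, CL2SmoothForms.toForm o₀ a = CL2SmoothForms.toForm o₀ b → a = b :=
    fun a b hab ↦ Subtype.ext hab
  have htoF₂ : ∀ a b : CL2SmoothForms (o z₂) k, CL2SmoothForms.toForm (o z₂) a = CL2SmoothForms.toForm (o z₂) b → a = b :=
    fun a b hab ↦ Subtype.ext hab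
  have hdiff_form : CL2SmoothForms.toForm o₀ (L z c - L z₂ c) =
      (θz.pullback 𝓘(ℝ, EX) Ψ - θ₂).pullback 𝓘(ℝ, EX) (e z₂ hz₂r) := by
    rw [CL2SmoothForms.toForm_sub, hL z hzr c, hL z₂ hz₂r c, ← hSz, ← hS₂, ← hηz, ← hη₂, ← hθz, ← hθ₂]
    rw [← MForm.cpullbackₗ_apply, ← MForm.cpullbackₗ_apply, ← MForm.cpullbackₗ_apply, ← MForm.cpullbackₗ_apply, map_sub,
      MForm.cpullbackₗ_apply, MForm.cpullbackₗ_apply, MForm.cpullbackₗ_apply, MForm.cpullbackₗ_apply,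
      ← MForm.pullback_comp (Ψ.mdifferentiable (by simp)) ((e z₂ hz₂r).mdifferentiable (by simp))]
    congr 1
    have hfun : ((Ψ : _ → _) ∘ ((e z₂ hz₂r) : X s₀ → _)) = ((e z hzr) : X s₀ → _) := by
      funext y
      simp [hΨ, Diffeomorph.coe_trans]
    rw [hfun]
  -- (D) transfer to the central fibre
  have hsmall_s : IsSmoothForm (θz.pullback 𝓘(ℝ, EX) Ψ - θ₂) := hΨθs.sub hθ₂s
  have hDz := hcmp z₂ hz₂r hz₂ _ hsmall_s
  have hnorm_eq : ‖L z c - L z₂ c‖ ^ 2 =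
      (MForm.cl2Inner o₀ ((θz.pullback 𝓘(ℝ, EX) Ψ - θ₂).pullback 𝓘(ℝ, EX) (e z₂ hz₂r))
        ((θz.pullback 𝓘(ℝ, EX) Ψ - θ₂).pullback 𝓘(ℝ, EX) (e z₂ hz₂r))).re := by
    rw [CL2SmoothForms.norm_sq_eq, hdiff_form]
  have hnorm₂ : ‖CL2SmoothForms.mk (o z₂) (θz.pullback 𝓘(ℝ, EX) Ψ - θ₂) hsmall_s‖ ^ 2 =
      (MForm.cl2Inner (o z₂) (θz.pullback 𝓘(ℝ, EX) Ψ - θ₂) (θz.pullback 𝓘(ℝ, EX) Ψ - θ₂)).re :=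
    CL2SmoothForms.norm_mk_sq (o z₂) hsmall_s
  -- the `L²(X (c⁻¹ z₂))` estimate: (B) + (C)(A)
  have hsplit : CL2SmoothForms.mk (o z₂) (θz.pullback 𝓘(ℝ, EX) Ψ - θ₂) hsmall_s =
      (CL2SmoothForms.mk (o z₂) (θz.pullback 𝓘(ℝ, EX) Ψ) hΨθs - CL2SmoothForms.mk (o z₂) πΨη hπΨηs) +
        CL2SmoothForms.mk (o z₂) (∑ pq ∈ Sp, (ηz.pullback 𝓘(ℝ, EX) Ψ - η₂).typeComponent pq.1 pq.2) hπdiffs := by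
    apply htoF₂
    simp only [CL2SmoothForms.toForm_add, CL2SmoothForms.toForm_sub, CL2SmoothForms.toForm_mk, hπΨη, hθ₂]
    have : ∀ pq ∈ Sp, (ηz.pullback 𝓘(ℝ, EX) Ψ - η₂).typeComponent pq.1 pq.2 =
        (ηz.pullback 𝓘(ℝ, EX) Ψ).typeComponent pq.1 pq.2 - η₂.typeComponent pq.1 pq.2 :=
      fun pq _ ↦ MForm.typeComponent_sub _ _ _ _
    rw [Finset.sum_congr rfl this, Finset.sum_sub_distrib]
    abel
  have hest₂ : ‖CL2SmoothForms.mk (o z₂) (θz.pullback 𝓘(ℝ, EX) Ψ - θ₂) hsmall_s‖ ≤ (2 * Cst + ((k : ℝ) + 1)) * ε₁ * (n₂ + 1) := by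
    rw [hsplit]
    refine (norm_add_le _ _).trans ?_
    have h1 : ‖CL2SmoothForms.mk (o z₂) (θz.pullback 𝓘(ℝ, EX) Ψ) hΨθs - CL2SmoothForms.mk (o z₂) πΨη hπΨηs‖ ≤
        Cst * ε₀ * ((1 + ε₁) * n₂) := by
      refine hBz.trans ?_
      exact mul_le_mul_of_nonneg_left hnormΨη (by positivity)
    have h2 : ‖CL2SmoothForms.mk (o z₂) (∑ pq ∈ Sp, (ηz.pullback 𝓘(ℝ, EX) Ψ - η₂).typeComponent pq.1 pq.2) hπdiffs‖ ≤
        ((k : ℝ) + 1) * (ε₁ * n₂) := by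
      refine hCz.trans ?_
      refine mul_le_mul_of_nonneg_left ?_ (by positivity)
      have h3 : CL2SmoothForms.mk (o z₂) (ηz.pullback 𝓘(ℝ, EX) Ψ - η₂) hdiffs =
          CL2SmoothForms.mk (o z₂) (ηz.pullback 𝓘(ℝ, EX) Ψ) hΨηs - CL2SmoothForms.mk (o z₂) η₂ hη₂h.1 :=
        htoF₂ _ _ (by simp only [CL2SmoothForms.toForm_sub, CL2SmoothForms.toForm_mk])
      rw [h3, hn₂]
      exact hAz
    have hk0 : (0 : ℝ) ≤ (k : ℝ) + 1 := by positivity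
    have h1' : Cst * ε₀ * ((1 + ε₁) * n₂) ≤ 2 * Cst * ε₁ * (n₂ + 1) := by
      have a0 : (1 + ε₁) * n₂ ≤ 2 * (n₂ + 1) := by nlinarith [hε₁1, hn₂0, hε₁pos.le]
      have a1 : ε₀ * ((1 + ε₁) * n₂) ≤ ε₁ * (2 * (n₂ + 1)) :=
        mul_le_mul hε₀1 a0 (by positivity) hε₁pos.le
      calc Cst * ε₀ * ((1 + ε₁) * n₂) = Cst * (ε₀ * ((1 + ε₁) * n₂)) := by ring
        _ ≤ Cst * (ε₁ * (2 * (n₂ + 1))) := mul_le_mul_of_nonneg_left a1 hCst0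
        _ = 2 * Cst * ε₁ * (n₂ + 1) := by ring
    have h2' : ((k : ℝ) + 1) * (ε₁ * n₂) ≤ ((k : ℝ) + 1) * ε₁ * (n₂ + 1) := by
      have a2 : ε₁ * n₂ ≤ ε₁ * (n₂ + 1) := mul_le_mul_of_nonneg_left (by linarith) hε₁pos.le
      calc ((k : ℝ) + 1) * (ε₁ * n₂) ≤ ((k : ℝ) + 1) * (ε₁ * (n₂ + 1)) := mul_le_mul_of_nonneg_left a2 hk0
        _ = ((k : ℝ) + 1) * ε₁ * (n₂ + 1) := by ring
    calc _ ≤ Cst * ε₀ * ((1 + ε₁) * n₂) + ((k : ℝ) + 1) * (ε₁ * n₂) := add_le_add h1 h2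
      _ ≤ 2 * Cst * ε₁ * (n₂ + 1) + ((k : ℝ) + 1) * ε₁ * (n₂ + 1) := add_le_add h1' h2'
      _ = (2 * Cst + ((k : ℝ) + 1)) * ε₁ * (n₂ + 1) := by ring
  -- (D): `‖L z c − L z₂ c‖² ≤ 2 ‖…‖²_{L²(X (c⁻¹ z₂))}`
  have hfinal_sq : ‖L z c - L z₂ c‖ ^ 2 ≤ 2 * ((2 * Cst + ((k : ℝ) + 1)) * ε₁ * (n₂ + 1)) ^ 2 := by
    rw [hnorm_eq]
    refine hDz.trans ?_
    rw [← hnorm₂]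
    have h0 : 0 ≤ ‖CL2SmoothForms.mk (o z₂) (θz.pullback 𝓘(ℝ, EX) Ψ - θ₂) hsmall_s‖ := norm_nonneg _
    have hsq2 : ‖CL2SmoothForms.mk (o z₂) (θz.pullback 𝓘(ℝ, EX) Ψ - θ₂) hsmall_s‖ ^ 2 ≤
        ((2 * Cst + ((k : ℝ) + 1)) * ε₁ * (n₂ + 1)) ^ 2 :=
      pow_le_pow_left₀ h0 hest₂ 2
    linarith
  -- conclusion: `‖L z c − L z₂ c‖ ≤ K₀ ε₁ ≤ ε / 2 < ε`
  have hK : ‖L z c - L z₂ c‖ ≤ K₀ * ε₁ := by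
    have hsq : ‖L z c - L z₂ c‖ ^ 2 ≤ (K₀ * ε₁) ^ 2 := by
      have hK₀eq : (K₀ * ε₁) ^ 2 = 4 * ((2 * Cst + ((k : ℝ) + 1)) * ε₁ * (n₂ + 1)) ^ 2 := by rw [hK₀]; ring
      rw [hK₀eq]
      have hT := sq_nonneg ((2 * Cst + ((k : ℝ) + 1)) * ε₁ * (n₂ + 1))
      linarith [hfinal_sq]
    exact (pow_le_pow_iff_left₀ (norm_nonneg _) (by positivity) two_ne_zero).1 hsq
  have hKε : K₀ * ε₁ ≤ ε / 2 := by
    have := mul_le_mul_of_nonneg_left hε₁ε hK₀pos.le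
    calc K₀ * ε₁ ≤ K₀ * (ε / (2 * K₀)) := this
      _ = ε / 2 := by field_simp
  rw [dist_eq_norm]
  linarith

end ChartBall

end Literature.AlgebraicGeometry.HodgeTheory

end
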